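import Literature.Probability.Percolation.CerfUniquenessZoneBound
import HarnessLib

/-!
# Crux `PercShatteringRace.NearLinearTwoClusterDecay` (stmt-CriticalPhenomena-5785) — engine stub E4 `stub_relayBootstrap`

Helper file of the line `pair-decay-long-arms-dense` (lead c5); lands with `--supports stmt-CriticalPhenomena-5785`
(registered stub `stub_relayBootstrap` of skeleton rev L5-c5).

**Statement.** From the relay step (E2), the lossy step (E1) and an initial two-cluster rate (E3) — taken here as
hypothesis schemas — a two-arms exponent `κ` and an occupation rate `σ` with `6 < κ(1+σ)` and
`(6+σ)/(κ(1+σ)−6) < 1+b` give in-box connection of the centre to every site of `box 3 n` inside the box of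
side `⌈n^{1+b}⌉₊` with probability bounded below, eventually in `n`.

**Proof sketch.** Pure real analysis over the three schemas; no percolation content is used. Writing `Pair x` for
the two-point lower bound at aspect `x`, one *round* (E1 then E2) upgrades `Pair x` to `Pair x'` for every
`x' > F x`, where `F x = max (1, (6+6x+σ)/(κ(1+σ)), x/(1+σ))` (`round_step`). The map `F` is dominated by the
affine contraction `x ↦ x⋆ + L (x − x⋆)₊` with `x⋆ = max (1, (6+σ)/(κ(1+σ)−6)) < 1+b` and
`L = max (6/(κ(1+σ)), 1/(1+σ)) < 1` (`key_bound`), so finitely many rounds from the E3 start bring the aspect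
below `1+b` (`iterate`, `bootstrap`); `Pair (1+b)` specialised at the centre is the claim.
-/

noncomputable section

namespace Summit.CriticalPhenomena.PercolationContinuityZ3.Theorems

namespace NearLinearTwoClusterDecayRelayBootstrap

open MeasureTheory Filter Topology
open Literature.Probability.LatticeModels Literature.Probability.Percolation

/-- The relay-exponent choice: if `A < (1+σ) x'` and `1 < x'` there is `γ ∈ (1/(1+σ), 1]` with
`max 1 (γ A) < x'`. -/
theorem exists_gamma {σ A x' : ℝ} (hσ : 0 < σ) (hA : 0 < A) (hAx : A < (1 + σ) * x')
    (hx' : 1 < x') : ∃ γ : ℝ, 1 / (1 + σ) < γ ∧ γ ≤ 1 ∧ max 1 (γ * A) < x' := by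
  have hσ1 : (0 : ℝ) < 1 + σ := by linarith
  have hq1 : 1 / (1 + σ) < 1 := (div_lt_one hσ1).2 (by linarith)
  have hqr : 1 / (1 + σ) < x' / A := by
    rw [div_lt_div_iff₀ hσ1 hA]; linarith
  refine ⟨min 1 ((1 / (1 + σ) + x' / A) / 2), lt_min hq1 (by linarith), min_le_left _ _,
    max_lt hx' ?_⟩
  calc min 1 ((1 / (1 + σ) + x' / A) / 2) * A ≤ (1 / (1 + σ) + x' / A) / 2 * A :=
        mul_le_mul_of_nonneg_right (min_le_right _ _) hA.le
    _ < x' / A * A := mul_lt_mul_of_pos_right (by linarith) hA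
    _ = x' := div_mul_cancel₀ x' hA.ne'

/-- **One round** (E1 then E2): `Pair x` upgrades to `Pair x'` for every `x'` above the round map
`F x = max (1, (6+6x+σ)/(κ(1+σ)), x/(1+σ))`. -/
theorem round_step {Pr : ℝ → Prop} {Rt : ℝ → ℝ → Prop} {κ σ : ℝ} (hκ : 0 < κ) (hσ : 0 < σ)
    (hE2 : ∀ A ζ γ : ℝ, 1 ≤ A → 0 < ζ → 1 / (1 + σ) < γ → 1 / (1 + ζ) < γ → γ ≤ 1 → Rt A ζ →
      ∀ x : ℝ, max 1 (γ * A) < x → Pr x)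
    (hE1 : ∀ x A : ℝ, 1 ≤ x → x < A → Pr x → ∀ ζ : ℝ, ζ ≤ κ * A - 6 - 6 * x → Rt A ζ)
    {x x' : ℝ} (hx : 1 ≤ x)
    (hF : max 1 (max ((6 + 6 * x + σ) / (κ * (1 + σ))) (x / (1 + σ))) < x') (hP : Pr x) :
    Pr x' := by
  have hσ1 : (0 : ℝ) < 1 + σ := by linarith
  have hκσ : 0 < κ * (1 + σ) := mul_pos hκ hσ1
  obtain ⟨h1x', hF2⟩ := max_lt_iff.1 hF
  obtain ⟨hFa, hFb⟩ := max_lt_iff.1 hF2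
  rcases lt_or_ge (κ * x) (6 + 6 * x + σ) with hcase | hcase
  · -- lossy regime: relay at aspect `A = (6+6x+σ)/κ` with rate `σ`
    obtain ⟨A, hA⟩ : ∃ A : ℝ, A = (6 + 6 * x + σ) / κ := ⟨_, rfl⟩
    have hκA : κ * A = 6 + 6 * x + σ := by rw [hA]; field_simp
    have hxA : x < A := by rw [hA, lt_div_iff₀ hκ]; linarith
    have hA1 : 1 ≤ A := by linarith
    have hR : Rt A σ := hE1 x A hx hxA hP σ (by linarith)
    have hAx : A < (1 + σ) * x' := by
      have h1 : 6 + 6 * x + σ < x' * (κ * (1 + σ)) := (div_lt_iff₀ hκσ).1 hFa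
      have h2 : κ * A < κ * ((1 + σ) * x') := by
        calc κ * A = 6 + 6 * x + σ := hκA
          _ < x' * (κ * (1 + σ)) := h1
          _ = κ * ((1 + σ) * x') := by ring
      exact lt_of_mul_lt_mul_left h2 hκ.le
    obtain ⟨γ, hγ1, hγ2, hγ3⟩ := exists_gamma hσ (by linarith) hAx h1x'
    exact hE2 A σ γ hA1 hσ hγ1 hγ1 hγ2 hR x' hγ3
  · -- dense regime: relay at an aspect `A ∈ (x, (1+σ) x')` with rate `κ A − 6 − 6x > σ`
    have hxM : x < (1 + σ) * x' := by
      have := (div_lt_iff₀ hσ1).1 hFb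
      linarith
    obtain ⟨A, hA⟩ : ∃ A : ℝ, A = (x + (1 + σ) * x') / 2 := ⟨_, rfl⟩
    have hxA : x < A := by rw [hA]; linarith
    have hAM : A < (1 + σ) * x' := by rw [hA]; linarith
    have hA1 : 1 ≤ A := by linarith
    have hκAx : 0 < κ * (A - x) := mul_pos hκ (by linarith)
    have hζσ : σ < κ * A - 6 - 6 * x := by nlinarith
    have hζ : 0 < κ * A - 6 - 6 * x := lt_trans hσ hζσ
    have hR : Rt A (κ * A - 6 - 6 * x) := hE1 x A hx hxA hP (κ * A - 6 - 6 * x) le_rfl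
    obtain ⟨γ, hγ1, hγ2, hγ3⟩ := exists_gamma hσ (by linarith) hAM h1x'
    have h1ζ : 1 / (1 + (κ * A - 6 - 6 * x)) < γ :=
      lt_trans (one_div_lt_one_div_of_lt hσ1 (by linarith)) hγ1
    exact hE2 A (κ * A - 6 - 6 * x) γ hA1 hζ hγ1 h1ζ hγ2 hR x' hγ3

/-- **Contraction bound** for the round map: if `x ≤ x⋆ + m` with `m ≥ 0`, then `F x ≤ x⋆ + L m`, for any
`x⋆ ≥ max (1, (6+σ)/(κ(1+σ)−6))` and any `L ≥ max (6/(κ(1+σ)), 1/(1+σ))`. -/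
theorem key_bound {κ σ xs L x m : ℝ} (hκ : 0 < κ) (hσ : 0 < σ) (h6 : 6 < κ * (1 + σ))
    (hxs1 : 1 ≤ xs) (hxs2 : (6 + σ) / (κ * (1 + σ) - 6) ≤ xs) (hL1 : 6 / (κ * (1 + σ)) ≤ L)
    (hL2 : 1 / (1 + σ) ≤ L) (hm : 0 ≤ m) (hx : x ≤ xs + m) :
    max 1 (max ((6 + 6 * x + σ) / (κ * (1 + σ))) (x / (1 + σ))) ≤ xs + L * m := by
  have hσ1 : (0 : ℝ) < 1 + σ := by linarith
  have hK0 : 0 < κ * (1 + σ) := mul_pos hκ hσ1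
  have hK6 : 0 < κ * (1 + σ) - 6 := by linarith
  have hLm : 0 ≤ L * m := mul_nonneg (le_trans (div_nonneg (by norm_num) hK0.le) hL1) hm
  refine max_le (by linarith) (max_le ?_ ?_)
  · have h2 : 6 + σ ≤ xs * (κ * (1 + σ) - 6) := (div_le_iff₀ hK6).1 hxs2
    have h3 : (6 + 6 * x + σ) / (κ * (1 + σ)) - 6 / (κ * (1 + σ)) * m ≤ xs := by
      rw [show (6 + 6 * x + σ) / (κ * (1 + σ)) - 6 / (κ * (1 + σ)) * m
          = (6 + 6 * x + σ - 6 * m) / (κ * (1 + σ)) by ring, div_le_iff₀ hK0]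
      nlinarith
    have h4 : 6 / (κ * (1 + σ)) * m ≤ L * m := mul_le_mul_of_nonneg_right hL1 hm
    linarith
  · have h1 : x / (1 + σ) ≤ (xs + m) / (1 + σ) := div_le_div_of_nonneg_right hx hσ1.le
    have h2 : (xs + m) / (1 + σ) = xs / (1 + σ) + 1 / (1 + σ) * m := by ring
    have h3 : xs / (1 + σ) ≤ xs := div_le_self (by linarith) (by linarith)
    have h4 : 1 / (1 + σ) * m ≤ L * m := mul_le_mul_of_nonneg_right hL2 hm
    linarith

/-- **Iteration**: after `n` rounds from the start `x₀` the aspect exponent is at most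
`x⋆ + Lⁿ x₀ + (T − x⋆)/2`. -/
theorem iterate {Pr : ℝ → Prop} {κ σ xs L T x₀ : ℝ} (hκ : 0 < κ) (hσ : 0 < σ)
    (h6 : 6 < κ * (1 + σ)) (hxs1 : 1 ≤ xs) (hxs2 : (6 + σ) / (κ * (1 + σ) - 6) ≤ xs)
    (hL1 : 6 / (κ * (1 + σ)) ≤ L) (hL2 : 1 / (1 + σ) ≤ L) (hL3 : L < 1) (hT : xs < T)
    (hround : ∀ x x' : ℝ, 1 ≤ x →
      max 1 (max ((6 + 6 * x + σ) / (κ * (1 + σ))) (x / (1 + σ))) < x' → Pr x → Pr x')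
    (hx₀ : 1 ≤ x₀) (hP₀ : Pr x₀) (n : ℕ) :
    ∃ x : ℝ, 1 ≤ x ∧ Pr x ∧ x ≤ xs + (L ^ n * x₀ + (T - xs) / 2) := by
  induction n with
  | zero => exact ⟨x₀, hx₀, hP₀, by rw [pow_zero, one_mul]; linarith⟩
  | succ n ih =>
    obtain ⟨x, hx1, hPx, hxle⟩ := ih
    have hL0 : 0 ≤ L := le_trans (div_nonneg (by norm_num) (mul_pos hκ (by linarith)).le) hL1
    have hm0 : 0 ≤ L ^ n * x₀ + (T - xs) / 2 :=
      add_nonneg (mul_nonneg (pow_nonneg hL0 n) (by linarith)) (by linarith)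
    have hkey := key_bound hκ hσ h6 hxs1 hxs2 hL1 hL2 hm0 hxle
    have hη : 0 < (1 - L) * (T - xs) / 2 := div_pos (mul_pos (by linarith) (by linarith)) two_pos
    have hF1 : 1 ≤ max 1 (max ((6 + 6 * x + σ) / (κ * (1 + σ))) (x / (1 + σ))) := le_max_left _ _
    refine ⟨max 1 (max ((6 + 6 * x + σ) / (κ * (1 + σ))) (x / (1 + σ))) + (1 - L) * (T - xs) / 2,
      by linarith, hround x _ hx1 (lt_add_of_pos_right _ hη) hPx, ?_⟩
    have : L * (L ^ n * x₀ + (T - xs) / 2) + (1 - L) * (T - xs) / 2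
        = L ^ (n + 1) * x₀ + (T - xs) / 2 := by ring
    linarith

/-- **The bootstrap** (abstract form): from the E3 start, finitely many rounds reach every target `T` above the
fixed point `max (1, (6+σ)/(κ(1+σ)−6))` of the round map. -/
theorem bootstrap {Pr : ℝ → Prop} {Rt : ℝ → ℝ → Prop} {κ σ T : ℝ} (hκ : 0 < κ) (hσ : 0 < σ)
    (h6 : 6 < κ * (1 + σ)) (hfix : (6 + σ) / (κ * (1 + σ) - 6) < T) (hT1 : 1 < T)
    (hE2 : ∀ A ζ γ : ℝ, 1 ≤ A → 0 < ζ → 1 / (1 + σ) < γ → 1 / (1 + ζ) < γ → γ ≤ 1 → Rt A ζ →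
      ∀ x : ℝ, max 1 (γ * A) < x → Pr x)
    (hE1 : ∀ x A : ℝ, 1 ≤ x → x < A → Pr x → ∀ ζ : ℝ, ζ ≤ κ * A - 6 - 6 * x → Rt A ζ)
    (hE3 : ∃ A ζ : ℝ, 1 ≤ A ∧ 0 < ζ ∧ Rt A ζ) : Pr T := by
  obtain ⟨A₀, ζ₀, hA₀, hζ₀, hR₀⟩ := hE3
  have hσ1 : (0 : ℝ) < 1 + σ := by linarith
  have hK0 : 0 < κ * (1 + σ) := mul_pos hκ hσ1
  -- the start: `Pair (A₀ + 1)` from the initial rate by one relay with `γ = 1`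
  have hP₀ : Pr (A₀ + 1) :=
    hE2 A₀ ζ₀ 1 hA₀ hζ₀ ((div_lt_one hσ1).2 (by linarith)) ((div_lt_one (by linarith)).2 (by linarith))
      le_rfl hR₀ (A₀ + 1) (max_lt (by linarith) (by linarith))
  have hx₀ : (1 : ℝ) ≤ A₀ + 1 := by linarith
  have hround : ∀ x x' : ℝ, 1 ≤ x →
      max 1 (max ((6 + 6 * x + σ) / (κ * (1 + σ))) (x / (1 + σ))) < x' → Pr x → Pr x' :=
    fun x x' hx hF hP => round_step hκ hσ hE2 hE1 hx hF hP
  -- the fixed point `xs` and the Lipschitz constant `L` of the round map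
  obtain ⟨xs, hxs1, hxs2, hxsT⟩ :
      ∃ xs : ℝ, 1 ≤ xs ∧ (6 + σ) / (κ * (1 + σ) - 6) ≤ xs ∧ xs < T :=
    ⟨max 1 ((6 + σ) / (κ * (1 + σ) - 6)), le_max_left _ _, le_max_right _ _, max_lt hT1 hfix⟩
  obtain ⟨L, hL1, hL2, hL0, hL3⟩ :
      ∃ L : ℝ, 6 / (κ * (1 + σ)) ≤ L ∧ 1 / (1 + σ) ≤ L ∧ 0 ≤ L ∧ L < 1 :=
    ⟨max (6 / (κ * (1 + σ))) (1 / (1 + σ)), le_max_left _ _, le_max_right _ _,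
      le_max_of_le_left (div_nonneg (by norm_num) hK0.le),
      max_lt ((div_lt_one hK0).2 h6) ((div_lt_one hσ1).2 (by linarith))⟩
  -- enough rounds to bring the error below `(T - xs) / 2`
  obtain ⟨n, hn⟩ := exists_pow_lt_of_lt_one
    (show 0 < (T - xs) / 2 / (A₀ + 1) from div_pos (by linarith) (by linarith)) hL3
  obtain ⟨x, hx1, hPx, hxle⟩ := iterate hκ hσ h6 hxs1 hxs2 hL1 hL2 hL3 hxsT hround hx₀ hP₀ n
  have hm0 : 0 ≤ L ^ n * (A₀ + 1) + (T - xs) / 2 :=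
    add_nonneg (mul_nonneg (pow_nonneg hL0 n) (by linarith)) (by linarith)
  have hkey := key_bound hκ hσ h6 hxs1 hxs2 hL1 hL2 hm0 hxle
  have hLn : L ^ n * (A₀ + 1) < (T - xs) / 2 :=
    (lt_div_iff₀ (show (0 : ℝ) < A₀ + 1 by linarith)).1 hn
  have hm1 : L * (L ^ n * (A₀ + 1) + (T - xs) / 2) ≤ L ^ n * (A₀ + 1) + (T - xs) / 2 :=
    mul_le_of_le_one_left hm0 hL3.le
  -- last round, landing exactly at `T`
  exact hround x T hx1 (by linarith) hPx

end NearLinearTwoClusterDecayRelayBootstrap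

open MeasureTheory Filter Topology
open Literature.Probability.LatticeModels Literature.Probability.Percolation
open NearLinearTwoClusterDecayRelayBootstrap

/-- **Engine stub E4 `stub_relayBootstrap` of the line `pair-decay-long-arms-dense`** (registered): the bootstrap —
from the relay step (E2), the lossy step (E1) and an initial two-cluster rate (E3), a two-arms exponent `κ` and an
occupation rate `σ` with `6 < κ(1+σ)` and `(6+σ)/(κ(1+σ)−6) < 1+b` give in-box long-range order from the centre at
aspect `n^{1+b}` in the jump world. [folklore] -/
theorem stub_relayBootstrap :
    (∀ σ A ζ γ : ℝ, 0 < σ → 1 ≤ A → 0 < ζ → 1 / (1 + σ) < γ → 1 / (1 + ζ) < γ → γ ≤ 1 →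
      (0 < theta (zdGraph 3) 0 (criticalProbI 3) → ∃ C : ℝ, ∀ u : ℕ, 1 ≤ u →
          (bondPercolation (zdGraph 3) (criticalProbI 3)).real {ω | ∀ x ∈ box 3 u, ω ∉ percolatesAt x} ≤ C * (u : ℝ) ^ (-σ)) →
      (0 < theta (zdGraph 3) 0 (criticalProbI 3) → ∃ C : ℝ, ∀ᶠ u : ℕ in atTop,
          (bondPercolation (zdGraph 3) (criticalProbI 3)).real (@uniqZone 3 u ⌈(u : ℝ) ^ A⌉₊)ᶜ ≤ C * (u : ℝ) ^ (-ζ)) →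
      ∀ x : ℝ, max 1 (γ * A) < x →
      (0 < theta (zdGraph 3) 0 (criticalProbI 3) → ∃ δ : ℝ, 0 < δ ∧ ∀ᶠ u : ℕ in atTop, ∀ a ∈ box 3 u, ∀ b ∈ box 3 u,
          δ ≤ (bondPercolation (zdGraph 3) (criticalProbI 3)).real (openConnIn (↑(box 3 ⌈(u : ℝ) ^ x⌉₊) : Set (Site 3)) a b))) →
    (∀ x κ A : ℝ, 1 ≤ x → 0 < κ → x < A →
      (∃ C : ℝ, ∀ i : Fin 3, ∀ m : ℕ, 1 ≤ m → (bondPercolation (zdGraph 3) (criticalProbI 3)).real (AKN.edgeTwoArms i m) ≤ C * (m : ℝ) ^ (-κ)) →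
      (0 < theta (zdGraph 3) 0 (criticalProbI 3) → ∃ δ : ℝ, 0 < δ ∧ ∀ᶠ u : ℕ in atTop, ∀ a ∈ box 3 u, ∀ b ∈ box 3 u,
          δ ≤ (bondPercolation (zdGraph 3) (criticalProbI 3)).real (openConnIn (↑(box 3 ⌈(u : ℝ) ^ x⌉₊) : Set (Site 3)) a b)) →
      ∀ ζ : ℝ, ζ ≤ κ * A - 6 - 6 * x →
      (0 < theta (zdGraph 3) 0 (criticalProbI 3) → ∃ C : ℝ, ∀ᶠ u : ℕ in atTop,
          (bondPercolation (zdGraph 3) (criticalProbI 3)).real (@uniqZone 3 u ⌈(u : ℝ) ^ A⌉₊)ᶜ ≤ C * (u : ℝ) ^ (-ζ))) →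
    (∃ A ζ : ℝ, 1 ≤ A ∧ 0 < ζ ∧
      (0 < theta (zdGraph 3) 0 (criticalProbI 3) → ∃ C : ℝ, ∀ᶠ u : ℕ in atTop,
          (bondPercolation (zdGraph 3) (criticalProbI 3)).real (@uniqZone 3 u ⌈(u : ℝ) ^ A⌉₊)ᶜ ≤ C * (u : ℝ) ^ (-ζ))) →
    ∀ κ σ b : ℝ, 0 < κ → 0 < σ → 0 < b → 6 < κ * (1 + σ) → (6 + σ) / (κ * (1 + σ) - 6) < 1 + b →
    (∃ C : ℝ, ∀ i : Fin 3, ∀ m : ℕ, 1 ≤ m → (bondPercolation (zdGraph 3) (criticalProbI 3)).real (AKN.edgeTwoArms i m) ≤ C * (m : ℝ) ^ (-κ)) →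
    (0 < theta (zdGraph 3) 0 (criticalProbI 3) → ∃ C : ℝ, ∀ u : ℕ, 1 ≤ u →
          (bondPercolation (zdGraph 3) (criticalProbI 3)).real {ω | ∀ x ∈ box 3 u, ω ∉ percolatesAt x} ≤ C * (u : ℝ) ^ (-σ)) →
    (0 < theta (zdGraph 3) 0 (criticalProbI 3) → ∃ c : ℝ, 0 < c ∧ ∀ᶠ n : ℕ in atTop, ∀ y ∈ box 3 n,
        c ≤ (bondPercolation (zdGraph 3) (criticalProbI 3)).real (openConnIn (↑(box 3 ⌈(n : ℝ) ^ (1 + b)⌉₊) : Set (Site 3)) 0 y)) := by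
  intro hE2 hE1 hE3 κ σ b hκ hσ hb h6 hfix hT hO hθ
  have hP := bootstrap (T := 1 + b)
    (Pr := fun x : ℝ => (0 < theta (zdGraph 3) 0 (criticalProbI 3) → ∃ δ : ℝ, 0 < δ ∧
      ∀ᶠ u : ℕ in atTop, ∀ a ∈ box 3 u, ∀ b ∈ box 3 u,
        δ ≤ (bondPercolation (zdGraph 3) (criticalProbI 3)).real
          (openConnIn (↑(box 3 ⌈(u : ℝ) ^ x⌉₊) : Set (Site 3)) a b)))
    (Rt := fun A ζ : ℝ => (0 < theta (zdGraph 3) 0 (criticalProbI 3) → ∃ C : ℝ, ∀ᶠ u : ℕ in atTop,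
      (bondPercolation (zdGraph 3) (criticalProbI 3)).real (@uniqZone 3 u ⌈(u : ℝ) ^ A⌉₊)ᶜ ≤
        C * (u : ℝ) ^ (-ζ)))
    hκ hσ h6 hfix (by linarith)
    (fun A ζ γ hA hζ h1 h2 h3 hR x hx => hE2 σ A ζ γ hσ hA hζ h1 h2 h3 hO hR x hx)
    (fun x A hx hxA hP ζ hζ => hE1 x κ A hx hκ hxA hT hP ζ hζ) hE3
  obtain ⟨δ, hδ, hev⟩ := hP hθ
  exact ⟨δ, hδ, hev.mono fun n hn y hy => hn 0 (zero_mem_box 3 n) y hy⟩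

end Summit.CriticalPhenomena.PercolationContinuityZ3.Theorems
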